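import Summits.ValiantsHypothesis.ValiantsHypothesis.Theorems.LacunarySymmetroidMatrixDescartesCensusDoorA34StrataSubStrata

/-!
# `MatrixDescartes` census — DOOR A at `(3,4)`: DESCARTES CEILINGS of the deeper sheets of the flag (monomial count: `≤ 16` two sheets down, `≤ 15` on the isotropic core)

HONEST FRAMING.  Object-search cell `pub-symmetroid`, engine seat `val-sym-eng-2` (g2); helper file beside the registered strata line
`Cruxes/DoorA34/Lines/strata.lean` on stmt-ValiantsHypothesis-19980 (`DoorA34 = PosRootLawAt 3 4 18`: OPEN, typed, never asserted here).
p575885 (`…StrataSubStrata`) closed the first sub-stratum of the null-top stratum by monomial count (`det S₃ = 0`, `tr(adj S₃·S₂) = 0` ⇒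
`≤ 18` monomials ⇒ `≤ 17` positive roots).  This file records the same elementary ceilings for the next two sheets of the descending flag
(companions `…SubStratumLift*`, `…SubSubStratumFifteen`, `…IsotropicCoreThirteen`, `…BorderedNine`) — the Descartes column of the ladder:

* `support_det_pencil_subSubStratum_subset` — `det S₃ = 0`, `tr(adj S₃·S₂) = 0`, `tr(adj S₃·S₁) = 0` ⇒ `supp(det F) ⊆ T₃ ∪ (d₃ + P₃) ∪ {2d₃ + d₀}`
  (`T₃` triple sums, `P₃` pair sums of the lower three exponents); `card_support_le_17_of_subSubStratum`, `posRoots_le_16_of_subSubStratum`;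
* `support_det_pencil_isotropicCore_subset` — additionally `tr(adj S₃·S₀) = 0` ⇒ `supp ⊆ T₃ ∪ (d₃ + P₃)` (the whole top block is gone:
  `det F = det G + X^{d₃}·tr(adj G·S₃)`); `card_support_le_16_of_isotropicCore`, `posRoots_le_15_of_isotropicCore`.

READING: these are the trivial ceilings (`16`, `15`) that the door LOWERS by one in chain currency (`…SubStratumLiftDeep/Top/CoreTop`: door
⇒ `≤ 15`, `≤ 14`); the exact objects of record carry `15` (p596640) and `13` (p601867).  Any `d`, any real letters; nothing here bounds
`ζ_sym(3,4)` (registers `18 ≤ ζ_sym(3,4) ≤ 19` unchanged); `DoorA34` and the stubs stay OPEN; nothing bears on `MatrixDescartes`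
(stmt-ValiantsHypothesis-18050) or `VP ≠ VNP` — VP≠VNP not moved.

[folklore] Descartes' rule of signs; support bookkeeping.
-/

-- `Summit.ValiantsHypothesis.ValiantsHypothesis.…` repeats a component by the D-0017 layout
-- (single-conjunct summit), which the `dupNamespace` linter flags; the name is mandated.
set_option linter.dupNamespace false

namespace Summit.ValiantsHypothesis.ValiantsHypothesis.Theorems.LacunarySymmetroidMatrixDescartes.Census

open Polynomial Finset
open scoped BigOperators Polynomial Matrix

/-- **Coefficient bookkeeping two sheets down.**  With `det S₃ = 0`, `tr(adj S₃·S₂) = 0` and `tr(adj S₃·S₁) = 0`, an exponent in the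
support of `det F` that is neither a triple sum of the lower exponents (`T₃`, block `det G`) nor `d₃` plus a pair sum (`d₃ + P₃`, block
`X^{d₃}·tr(adj G·S₃)`) can only be `2d₃ + d₀`, and then `tr(adj S₃·S₀) ≠ 0` (block `X^{2d₃}·tr(adj S₃·G)`). [folklore] -/
theorem eq_top_add_bottom_of_mem_support_subSubStratum (d : Fin 4 → ℕ) (S : Fin 4 → Matrix (Fin 3) (Fin 3) ℝ) (h3 : (S 3).det = 0)
    (htr2 : ((S 3).adjugate * S 2).trace = 0) (htr1 : ((S 3).adjugate * S 1).trace = 0) {n : ℕ}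
    (hn : n ∈ (Matrix.det (∑ l, ((X : ℝ[X]) ^ d l) • (S l).map C)).support)
    (hAB : n ∉ (Finset.univ : Finset (Sym (Fin 3) 3)).image
          (fun s : Sym (Fin 3) 3 => ((s : Multiset (Fin 3)).map (fun l => d (Fin.castSucc l))).sum)
        ∪ (Finset.univ : Finset (Fin 2 → Fin 3)).image (fun f => d 3 + ∑ i, d (Fin.castSucc (f i)))) :
    n = 2 * d 3 + d 0 ∧ ((S 3).adjugate * S 0).trace ≠ 0 := by
  rw [Polynomial.mem_support_iff, det_pencil_nullTop_eq_blocks d S h3, Polynomial.coeff_add, Polynomial.coeff_add] at hn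
  rcases not_or.mp (fun h => hAB (Finset.mem_union.mpr h)) with ⟨hA, hB⟩
  -- block `det G` contributes nothing at `n ∉ T₃`
  have hz1 : ((∑ l : Fin 3, (X : ℝ[X]) ^ d (Fin.castSucc l) • (S (Fin.castSucc l)).map C).det).coeff n = 0 :=
    Polynomial.notMem_support_iff.mp fun h =>
      hA (StubDescartesCeiling.support_det_pencil_subset (fun l : Fin 3 => d (Fin.castSucc l)) (fun l => S (Fin.castSucc l)) h)
  -- block `X^{d₃}·tr(adj G·S₃)` contributes nothing at `n ∉ d₃ + P₃`
  have hz2 : ((X : ℝ[X]) ^ d 3 * (((∑ l : Fin 3, (X : ℝ[X]) ^ d (Fin.castSucc l) • (S (Fin.castSucc l)).map C).adjugate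
      * (S 3).map C).trace)).coeff n = 0 := by
    rw [Polynomial.coeff_X_pow_mul']
    split_ifs with hle
    · simp only [Matrix.trace, Matrix.diag, Matrix.mul_apply, Matrix.map_apply, Polynomial.finsetSum_coeff,
        Polynomial.coeff_mul_C]
      refine Finset.sum_eq_zero fun i _ => Finset.sum_eq_zero fun j _ => ?_
      have h0 : ((∑ l : Fin 3, ((X : ℝ[X]) ^ d (Fin.castSucc l)) • (S (Fin.castSucc l)).map C).adjugate i j).coeff (n - d 3) = 0 :=
        Polynomial.notMem_support_iff.mp fun h => hB (by
          obtain ⟨f, hf, hfs⟩ := Finset.mem_image.mp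
            (support_adjugate_pencil_apply_subset' (fun l : Fin 3 => d (Fin.castSucc l)) (fun l => S (Fin.castSucc l)) i j h)
          exact Finset.mem_image.mpr ⟨f, hf, by omega⟩)
      rw [h0, zero_mul]
    · rfl
  rw [hz1, hz2, add_zero, zero_add, trace_adjugate_map_mul_corePencil, ← pow_mul, Polynomial.coeff_X_pow_mul'] at hn
  split_ifs at hn with hle
  · rw [Polynomial.finsetSum_coeff] at hn
    obtain ⟨l, -, hl⟩ := Finset.exists_ne_zero_of_sum_ne_zero hn
    rw [Polynomial.coeff_X_pow_mul'] at hl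
    split_ifs at hl with hle'
    · rw [Polynomial.coeff_C] at hl
      split_ifs at hl with heq
      · fin_cases l
        · have heq' : n - d 3 * 2 - d 0 = 0 := heq
          have hle'' : d 0 ≤ n - d 3 * 2 := hle'
          exact ⟨by omega, by simpa using hl⟩
        · exact absurd (by simpa using htr1) hl
        · exact absurd (by simpa using htr2) hl
      · exact absurd rfl hl
    · exact absurd rfl hl
  · exact absurd rfl hn

/-- **Support of the determinant two sheets down**: `det S₃ = 0`, `tr(adj S₃·S₂) = 0`, `tr(adj S₃·S₁) = 0` ⇒
`supp(det F) ⊆ (T₃ ∪ (d₃ + P₃)) ∪ {2d₃ + d₀}` (any `d`, any real letters). [folklore] -/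
theorem support_det_pencil_subSubStratum_subset (d : Fin 4 → ℕ) (S : Fin 4 → Matrix (Fin 3) (Fin 3) ℝ) (h3 : (S 3).det = 0)
    (htr2 : ((S 3).adjugate * S 2).trace = 0) (htr1 : ((S 3).adjugate * S 1).trace = 0) :
    (Matrix.det (∑ l, ((X : ℝ[X]) ^ d l) • (S l).map C)).support ⊆
      ((Finset.univ : Finset (Sym (Fin 3) 3)).image
          (fun s : Sym (Fin 3) 3 => ((s : Multiset (Fin 3)).map (fun l => d (Fin.castSucc l))).sum)
        ∪ (Finset.univ : Finset (Fin 2 → Fin 3)).image (fun f => d 3 + ∑ i, d (Fin.castSucc (f i))))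
      ∪ ({2 * d 3 + d 0} : Finset ℕ) := by
  intro n hn
  by_cases hAB : n ∈ (Finset.univ : Finset (Sym (Fin 3) 3)).image
      (fun s : Sym (Fin 3) 3 => ((s : Multiset (Fin 3)).map (fun l => d (Fin.castSucc l))).sum)
    ∪ (Finset.univ : Finset (Fin 2 → Fin 3)).image (fun f => d 3 + ∑ i, d (Fin.castSucc (f i)))
  · exact Finset.mem_union_left _ hAB
  · exact Finset.mem_union_right _ (Finset.mem_singleton.mpr
      (eq_top_add_bottom_of_mem_support_subSubStratum d S h3 htr2 htr1 hn hAB).1)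

/-- **Two sheets down ⇒ at most `17` monomials** (any `d`, any real letters). [folklore] -/
theorem card_support_le_17_of_subSubStratum (d : Fin 4 → ℕ) (S : Fin 4 → Matrix (Fin 3) (Fin 3) ℝ) (h3 : (S 3).det = 0)
    (htr2 : ((S 3).adjugate * S 2).trace = 0) (htr1 : ((S 3).adjugate * S 1).trace = 0) :
    (Matrix.det (∑ l, ((X : ℝ[X]) ^ d l) • (S l).map C)).support.card ≤ 17 := by
  classical
  refine (Finset.card_le_card (support_det_pencil_subSubStratum_subset d S h3 htr2 htr1)).trans ?_
  refine (Finset.card_union_le _ _).trans ?_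
  have hA : ((Finset.univ : Finset (Sym (Fin 3) 3)).image
      (fun s : Sym (Fin 3) 3 => ((s : Multiset (Fin 3)).map (fun l => d (Fin.castSucc l))).sum)).card ≤ 10 :=
    Finset.card_image_le.trans (by rw [Finset.card_univ, Sym.card_sym_eq_choose]; decide)
  have hB : ((Finset.univ : Finset (Fin 2 → Fin 3)).image (fun f => d 3 + ∑ i, d (Fin.castSucc (f i)))).card ≤ 6 := by
    have h6 := card_pairSums_three_le (fun l : Fin 3 => d (Fin.castSucc l))
    have : (Finset.univ : Finset (Fin 2 → Fin 3)).image (fun f => d 3 + ∑ i, d (Fin.castSucc (f i)))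
        = ((Finset.univ : Finset (Fin 2 → Fin 3)).image (fun f => ∑ i, d (Fin.castSucc (f i)))).image (fun n => d 3 + n) := by
      rw [Finset.image_image]; rfl
    rw [this]
    exact Finset.card_image_le.trans h6
  have hAB := (Finset.card_union_le _ _).trans (Nat.add_le_add hA hB)
  have hC : (({2 * d 3 + d 0} : Finset ℕ)).card ≤ 1 := by simp
  omega

/-- **DESCARTES CEILING TWO SHEETS DOWN: `≤ 16` positive roots** on `{det S₃ = 0, tr(adj S₃·S₂) = 0, tr(adj S₃·S₁) = 0}` (any `d`,
any real letters; `17` monomials ⇒ `16` sign changes at most).  The door lowers it to `15` in chain currency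
(`…SubStratumLiftDeep`); the exact object of record has `15` (p596640). [folklore] -/
theorem posRoots_le_16_of_subSubStratum (d : Fin 4 → ℕ) (S : Fin 4 → Matrix (Fin 3) (Fin 3) ℝ)
    (h3 : (S 3).det = 0) (htr2 : ((S 3).adjugate * S 2).trace = 0) (htr1 : ((S 3).adjugate * S 1).trace = 0) :
    ((Matrix.det (∑ l, ((X : ℝ[X]) ^ d l) • (S l).map C)).roots.toFinset.filter (fun t => 0 < t)).card ≤ 16 := by
  by_cases hP : Matrix.det (∑ l, ((X : ℝ[X]) ^ d l) • (S l).map C) = 0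
  · rw [hP, Polynomial.roots_zero, Multiset.toFinset_zero, Finset.filter_empty, Finset.card_empty]; omega
  have hlt := Literature.Computability.AlgebraicComplexity.card_roots_toFinset_filter_pos_lt_card_support hP
  have hc := card_support_le_17_of_subSubStratum d S h3 htr2 htr1
  omega

/-! ## Three sheets down: the isotropic core (`tr(adj S₃·S_l) = 0` for `l = 0, 1, 2`) -/

/-- **Support of the determinant on the isotropic core**: `det S₃ = 0` and `tr(adj S₃·S_l) = 0` for `l = 0,1,2` ⇒ the whole top block
`X^{2d₃}·tr(adj S₃·G)` vanishes and `supp(det F) ⊆ T₃ ∪ (d₃ + P₃)` (any `d`, any real letters). [folklore] -/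
theorem support_det_pencil_isotropicCore_subset (d : Fin 4 → ℕ) (S : Fin 4 → Matrix (Fin 3) (Fin 3) ℝ) (h3 : (S 3).det = 0)
    (htr2 : ((S 3).adjugate * S 2).trace = 0) (htr1 : ((S 3).adjugate * S 1).trace = 0)
    (htr0 : ((S 3).adjugate * S 0).trace = 0) :
    (Matrix.det (∑ l, ((X : ℝ[X]) ^ d l) • (S l).map C)).support ⊆
      (Finset.univ : Finset (Sym (Fin 3) 3)).image
          (fun s : Sym (Fin 3) 3 => ((s : Multiset (Fin 3)).map (fun l => d (Fin.castSucc l))).sum)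
        ∪ (Finset.univ : Finset (Fin 2 → Fin 3)).image (fun f => d 3 + ∑ i, d (Fin.castSucc (f i))) := by
  intro n hn
  by_contra hAB
  exact (eq_top_add_bottom_of_mem_support_subSubStratum d S h3 htr2 htr1 hn hAB).2 htr0

/-- **Isotropic core ⇒ at most `16` monomials** (any `d`, any real letters). [folklore] -/
theorem card_support_le_16_of_isotropicCore (d : Fin 4 → ℕ) (S : Fin 4 → Matrix (Fin 3) (Fin 3) ℝ) (h3 : (S 3).det = 0)
    (htr2 : ((S 3).adjugate * S 2).trace = 0) (htr1 : ((S 3).adjugate * S 1).trace = 0)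
    (htr0 : ((S 3).adjugate * S 0).trace = 0) :
    (Matrix.det (∑ l, ((X : ℝ[X]) ^ d l) • (S l).map C)).support.card ≤ 16 := by
  classical
  refine (Finset.card_le_card (support_det_pencil_isotropicCore_subset d S h3 htr2 htr1 htr0)).trans ?_
  refine (Finset.card_union_le _ _).trans ?_
  have hA : ((Finset.univ : Finset (Sym (Fin 3) 3)).image
      (fun s : Sym (Fin 3) 3 => ((s : Multiset (Fin 3)).map (fun l => d (Fin.castSucc l))).sum)).card ≤ 10 :=
    Finset.card_image_le.trans (by rw [Finset.card_univ, Sym.card_sym_eq_choose]; decide)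
  have hB : ((Finset.univ : Finset (Fin 2 → Fin 3)).image (fun f => d 3 + ∑ i, d (Fin.castSucc (f i)))).card ≤ 6 := by
    have h6 := card_pairSums_three_le (fun l : Fin 3 => d (Fin.castSucc l))
    have : (Finset.univ : Finset (Fin 2 → Fin 3)).image (fun f => d 3 + ∑ i, d (Fin.castSucc (f i)))
        = ((Finset.univ : Finset (Fin 2 → Fin 3)).image (fun f => ∑ i, d (Fin.castSucc (f i)))).image (fun n => d 3 + n) := by
      rw [Finset.image_image]; rfl
    rw [this]
    exact Finset.card_image_le.trans h6
  omega

/-- **DESCARTES CEILING ON THE ISOTROPIC CORE: `≤ 15` positive roots** on `{det S₃ = 0, tr(adj S₃·S_l) = 0 (l = 0,1,2)}` (any `d`,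
any real letters; `16` monomials ⇒ `15` sign changes at most).  The door lowers it to `14` in chain currency
(`…SubStratumLiftCoreTop`); the exact object of record has `13` (p601867); `14` is the located open value. [folklore] -/
theorem posRoots_le_15_of_isotropicCore (d : Fin 4 → ℕ) (S : Fin 4 → Matrix (Fin 3) (Fin 3) ℝ)
    (h3 : (S 3).det = 0) (htr2 : ((S 3).adjugate * S 2).trace = 0) (htr1 : ((S 3).adjugate * S 1).trace = 0)
    (htr0 : ((S 3).adjugate * S 0).trace = 0) :
    ((Matrix.det (∑ l, ((X : ℝ[X]) ^ d l) • (S l).map C)).roots.toFinset.filter (fun t => 0 < t)).card ≤ 15 := by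
  by_cases hP : Matrix.det (∑ l, ((X : ℝ[X]) ^ d l) • (S l).map C) = 0
  · rw [hP, Polynomial.roots_zero, Multiset.toFinset_zero, Finset.filter_empty, Finset.card_empty]; omega
  have hlt := Literature.Computability.AlgebraicComplexity.card_roots_toFinset_filter_pos_lt_card_support hP
  have hc := card_support_le_16_of_isotropicCore d S h3 htr2 htr1 htr0
  omega

end Summit.ValiantsHypothesis.ValiantsHypothesis.Theorems.LacunarySymmetroidMatrixDescartes.Census
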